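import Literature.Analysis.FluidPDE.ChaeGeneralizedSelfSimilar
import Literature.Analysis.FluidPDE.SwirlMaximumPrinciple
import Literature.Analysis.FluidPDE.VorticityEquation
import Literature.Analysis.FluidPDE.NSVorticityBKM
import Literature.Analysis.FluidPDE.NSVorticityBKMHolds
import Literature.Analysis.FluidPDE.NSVorticityBKMTools
import Mathlib.Analysis.SpecialFunctions.Integrability.Basic
import HarnessLib

/-!
# Chae 2010, Theorem 1.1 (the Type-I threshold `M(T) < 1 ⇒` no Euler blow-up), discharged

Analysis/FluidPDE proof file (no definitions, no named facts, no `sorry`): it DISCHARGES the named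
fact `Literature.Analysis.FluidPDE.chae2010_euler_typeI_threshold` of
`ChaeGeneralizedSelfSimilar.lean` — D. Chae, *On the generalized self-similar singularities for
the Euler and the Navier–Stokes equations*, J. Funct. Anal. 258 (2010) 2865–2883, **Theorem 1.1**
(= arXiv:0711.1113, Thm 1.1): for a classical Euler solution on `ℝ³ × [0, T)` of the
Beale–Kato–Majda class, `(T - t)‖∇v(t)‖_∞ ≤ M₀ < 1` on `[t₀, T)` forces continuation in the class
past `T` — as `chae2010_euler_typeI_threshold_holds`, and thereby makes the tree's Corollary 1.1
(`chae2010_euler_typeI_threshold.selfSimilarCollapse_continues` /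
`.exists_norm_fderiv_gt_of_blowup`: an exact self-similar Euler blow-up profile of the class has
`sup ‖DU‖ ≥ 1`, whatever its collapse exponent) unconditional
(`selfSimilarEulerCollapse_continues_of_norm_fderiv_lt_one`,
`exists_norm_fderiv_gt_of_selfSimilarEulerBlowup`).

## The printed proof (arXiv:0711.1113, p. 3–4) and how it is followed

> "We suppose `M(T) < 1`. Then, there exists `t₀ ∈ (0, T)` such that
> `sup_{t₀<t<T} (T−t)‖∇v(t)‖_∞ := M₀ < 1`. Taking curl of the evolution part of (E), we have the
> vorticity equation `∂ₜω + (v·∇)ω = (ω·∇)v`. This, taking dot product with `ξ = ω/|ω|`, leads to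
> `∂ₜ|ω| + (v·∇)|ω| = (ξ·∇)v·ξ |ω|`. Integrating this over `[t₀, t]` along the particle
> trajectories … we estimate `‖ω(t)‖_∞ ≤ ‖ω(t₀)‖_∞ exp[∫_{t₀}^t ‖∇v(τ)‖_∞ dτ] <
> ‖ω(t₀)‖_∞ exp[M₀∫_{t₀}^t (T−τ)⁻¹dτ] = ‖ω(t₀)‖_∞ ((T−t₀)/(T−t))^{M₀}`. Since `M₀ < 1`, we have
> `∫_{t₀}^T ‖ω(t)‖_∞ dt < ∞`, and thanks to the Beale–Kato–Majda criterion there exists no blow-up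
> at `T`, and we can continue our classical solution beyond `T`."

The three steps are mirrored one-to-one:

1. **The sup-norm growth of the vorticity under a gradient bound**
   (`exp_neg_mul_norm_curl_le_of_classicalEuler`): for a classical Euler solution on `[0, T)` with
   velocity and vorticity bounded on `[t₀, t₁] × ℝ³` and `‖D(u s)(x)‖ ≤ Λ′(s)` on `(t₀, t₁]`,
   `Λ(t₀) = 0`, one has `e^{−Λ(t)} ‖ω(t, x)‖ ≤ sup ‖ω(t₀, ·)‖` — i.e.
   `‖ω(t)‖_∞ ≤ ‖ω(t₀)‖_∞ exp ∫_{t₀}^t ‖∇v‖_∞` (the display of Chae's proof, p. 3; the Hölder-norm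
   version is Majda–Bertozzi 2002, (4.48)). ONE DEVIATION from print: instead of integrating along particle
   trajectories (no Lagrangian flow map is needed), the bound is obtained from the tree's abstract
   weak parabolic maximum principle `weak_max_principle` (`SwirlMaximumPrinciple.lean`, Lieberman
   1996 Ch. II; the case `ν = 0` is admissible — the sub-solution implication there is
   `∇w = 0 → Δw ≤ 0 → wₜ ≤ 0` and the Laplacian premise is simply not used), applied exactly as in
   the tree's conservation of the swirl for Euler flows (`abs_swirl_le_of_classicalEuler`) to
   `w = e^{−2Λ(t)}|ω|² − (M² + ε e^{β(t−t₀)}(1 + |x|²))`, `β = V + 1`, on large balls: at a critical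
   point `∇w = 0` the transport term `e^{−2Λ}(v·∇)|ω|² = (v·∇)h` is bounded by `2εe^{β(t−t₀)}|x|V`,
   the stretching term `2e^{−2Λ}⟪ω, Dv ω⟫ ≤ 2Λ′e^{−2Λ}|ω|²` cancels against the weight, and the
   barrier's own growth `βεe^{β(t−t₀)}(1+|x|²)` absorbs the rest; on the sphere `|x| = R` the
   barrier dominates the bounded vorticity. Letting `ε → 0` gives the claim.
2. **The rate** (`norm_curl_le_mul_rpow_of_typeI_gradient`): with `Λ(t) = M₀ log((T−t₀)/(T−t))`,
   `Λ′ = M₀/(T−t)`, step 1 reads `‖ω(t, x)‖ ≤ ‖ω(t₀)‖_∞ ((T−t₀)/(T−t))^{M₀}` on `[t₀, T)`.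
3. **Beale–Kato–Majda**: `M₀ < 1` makes `t ↦ (T−t)^{−M₀}` integrable on `(0, T)`, the vorticity is
   bounded on `[0, t₀]` in the class (`exists_enorm_curl_le_of_hasBoundedSobolevNormsOn`), so
   `∫₀ᵀ ‖ω(t)‖_∞ dt < ∞` and the tree's DISCHARGED criterion `beale_kato_majda_holds` (`ν = 0`
   admissible) continues the solution in the class past `T`.

The velocity/vorticity/gradient sup bounds on compact sub-slabs come from the BKM class through
the tree's Sobolev imbedding lemmas (`exists_forall_norm_iteratedFDeriv_le_bkmClass`,
`exists_enorm_curl_le_of_hasBoundedSobolevNormsOn`); the vorticity equation is the tree's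
`IsClassicalNSSolutionOn.isVorticitySolutionOn_Ico` (Majda–Bertozzi Prop. 2.21).

WHAT THIS IS NOT: not a statement about Navier–Stokes (`ν = 0` throughout, except that the growth
lemma of step 1 is stated for Euler only) and not a blow-up claim; a kernel proof of a printed
continuation criterion for classical Euler solutions.

## References

* D. Chae, J. Funct. Anal. 258 (2010) 2865–2883 = arXiv:0711.1113: Thm 1.1 and its proof
  (arXiv p. 3–4), Cor 1.1. [`Chae2010`]
* J. T. Beale, T. Kato, A. Majda, Comm. Math. Phys. 94 (1984) 61–66, Thm 1 (tree
  `beale_kato_majda`, discharged `beale_kato_majda_holds`). [`BealeKatoMajda1984`]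
* A. J. Majda, A. L. Bertozzi, *Vorticity and Incompressible Flow*, CUP 2002, Thm 3.6 (BKM),
  (4.48) of §4.2, held text chunk p0134 (`|ω(·,t)|_γ ≤ |ω₀|_γ exp[(C₀+γ)∫₀ᵗ|∇v(·,s)|₀ ds]`, the Hölder-norm form of the
  growth bound), Prop. 2.21 (vorticity equation). [`MajdaBertozziCUP2002`]
* G. M. Lieberman, *Second order parabolic differential equations*, World Scientific 1996,
  Ch. II, Lemmas 2.1, 2.3 (tree `weak_max_principle`). [`Lieberman1996`]
-/

noncomputable section

open MeasureTheory Set Function Filter Topology Metric InnerProductSpace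
open scoped RealInnerProductSpace NNReal ENNReal ContDiff Laplacian

namespace Literature.Analysis.FluidPDE

/-! ### Step 1: sup-norm growth of the vorticity under a gradient bound (Euler) -/

set_option maxHeartbeats 400000 in
/-- **Sup-norm growth of the vorticity of a classical Euler solution under a gradient bound**
(the step "`‖ω(t)‖_∞ ≤ ‖ω(t₀)‖_∞ exp[∫_{t₀}^t ‖∇v(τ)‖_∞ dτ]`" of Chae 2010, proof of Thm 1.1,
arXiv:0711.1113 p. 3; Hölder-norm form: Majda–Bertozzi 2002, (4.48)). Let `(u, p)` be
a classical solution of the unforced Euler system on `ℝ³ × [0, T)`, let `0 ≤ t₀ ≤ t₁ < T`, and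
assume on the slab `[t₀, t₁] × ℝ³` the bounds `|u| ≤ V`, `|ω| ≤ W` (`ω = curl u`), and
`|ω(t₀, ·)| ≤ M`. Let `Λ` be continuous and nonnegative on `[t₀, t₁]` with `Λ(t₀) = 0` and
derivative `Λ′(s) = λ(s) ≥ ‖D(u s)(x)‖` (operator norm) for `s ∈ (t₀, t₁]` and all `x`. Then
`e^{−Λ(t)} |ω(t, x)| ≤ M` on `[t₀, t₁] × ℝ³`. Proof by the weak maximum principle
(`weak_max_principle`, `ν = 0`) applied to `e^{−2Λ}|ω|² − (M² + εe^{β(t−t₀)}(1+|x|²))`,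
`β = V + 1`, on the balls `|x| ≤ R`, `R ≥ W²/ε` (module docstring, step 1).
[cite: Chae2010, Thm 1.1 (proof, arXiv:0711.1113 p. 3); MajdaBertozziCUP2002, §4.2 (4.48)] -/
theorem exp_neg_mul_norm_curl_le_of_classicalEuler
    {T t₀ t₁ V W M : ℝ} {u : ℝ → (EuclideanSpace ℝ (Fin 3)) → (EuclideanSpace ℝ (Fin 3))} {p : ℝ → (EuclideanSpace ℝ (Fin 3)) → ℝ} {Λ lam : ℝ → ℝ}
    (hcl : IsClassicalNSSolutionOn (Ico 0 T) 0 0 u p)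
    (ht₀ : 0 ≤ t₀) (h01 : t₀ ≤ t₁) (ht₁ : t₁ < T)
    (hV : ∀ t ∈ Icc t₀ t₁, ∀ x, ‖u t x‖ ≤ V)
    (hW : ∀ t ∈ Icc t₀ t₁, ∀ x, ‖curl (u t) x‖ ≤ W)
    (hM : ∀ x, ‖curl (u t₀) x‖ ≤ M)
    (hΛc : ContinuousOn Λ (Icc t₀ t₁)) (hΛ0 : Λ t₀ = 0) (hΛnn : ∀ t ∈ Icc t₀ t₁, 0 ≤ Λ t)
    (hΛd : ∀ t ∈ Ioc t₀ t₁, HasDerivAt Λ (lam t) t)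
    (hD : ∀ t ∈ Ioc t₀ t₁, ∀ x, ‖fderiv ℝ (u t) x‖ ≤ lam t) :
    ∀ t ∈ Icc t₀ t₁, ∀ x, Real.exp (-Λ t) * ‖curl (u t) x‖ ≤ M := by
  have hM0 : 0 ≤ M := (norm_nonneg _).trans (hM 0)
  have hV0 : 0 ≤ V := (norm_nonneg _).trans (hV t₀ ⟨le_rfl, h01⟩ 0)
  have hW0 : 0 ≤ W := (norm_nonneg _).trans (hW t₀ ⟨le_rfl, h01⟩ 0)
  -- the sub-slab lies inside `[0, T)`
  have hsubI : Icc t₀ t₁ ⊆ Ico 0 T := fun s hs => ⟨ht₀.trans hs.1, hs.2.trans_lt ht₁⟩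
  -- the vorticity: joint smoothness, the vorticity equation
  set om : ℝ → (EuclideanSpace ℝ (Fin 3)) → (EuclideanSpace ℝ (Fin 3)) := vorticity u with hom
  have hom_app : ∀ t x, om t x = curl (u t) x := fun t x => by rw [hom, vorticity_apply]
  have hsm := hcl.smooth_velocity
  have homsm : IsSmoothSpaceTimeOn (Ico 0 T) om := hsm.isSmoothSpaceTimeOn_vorticity (uniqueDiffOn_Ico 0 T)
  have hvort : IsVorticitySolutionOn (Ico 0 T) 0 u := hcl.isVorticitySolutionOn_Ico fun _ _ y => curl_zero y
  set omt : ℝ → (EuclideanSpace ℝ (Fin 3)) → (EuclideanSpace ℝ (Fin 3)) := fun t x => timeDerivWithin (Ico 0 T) om t x with homt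
  -- constants of the barrier
  set β : ℝ := V + 1 with hβ
  have hβ0 : 0 ≤ β := by rw [hβ]; positivity
  -- the claim for every `ε > 0`, on every large ball
  suffices key : ∀ ε : ℝ, 0 < ε → ∀ R : ℝ, W ^ 2 / ε ≤ R →
      ∀ t ∈ Icc t₀ t₁, ∀ x ∈ closedBall (0 : (EuclideanSpace ℝ (Fin 3))) R,
        Real.exp (-2 * Λ t) * ‖om t x‖ ^ 2 - (M ^ 2 + ε * Real.exp (β * (t - t₀)) * (1 + ‖x‖ ^ 2)) ≤ 0 by
    intro t ht x
    have hsq : Real.exp (-2 * Λ t) * ‖om t x‖ ^ 2 ≤ M ^ 2 := by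
      refine le_of_forall_pos_le_add fun η hη => ?_
      set C : ℝ := Real.exp (β * (t - t₀)) * (1 + ‖x‖ ^ 2) with hC
      have hCpos : 0 < C := by positivity
      have h := key (η / C) (div_pos hη hCpos) (max (W ^ 2 / (η / C)) ‖x‖) (le_max_left _ _) t ht x
        (mem_closedBall_zero_iff.2 (le_max_right _ _))
      have e : η / C * Real.exp (β * (t - t₀)) * (1 + ‖x‖ ^ 2) = η := by
        rw [hC]; field_simp
      rw [e] at h
      linarith
    have hexp : Real.exp (-2 * Λ t) = Real.exp (-Λ t) ^ 2 := by
      rw [← Real.exp_nat_mul]; congr 1; push_cast; ring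
    rw [hexp, ← mul_pow, hom_app] at hsq
    exact (pow_le_pow_iff_left₀ (by positivity) hM0 two_ne_zero).1 hsq
  intro ε hε R hR
  have hR0 : 0 ≤ R := le_trans (by positivity) hR
  -- the comparison function and its time derivative
  set w : ℝ → (EuclideanSpace ℝ (Fin 3)) → ℝ := fun t x =>
    Real.exp (-2 * Λ t) * ‖om t x‖ ^ 2 - (M ^ 2 + ε * Real.exp (β * (t - t₀)) * (1 + ‖x‖ ^ 2)) with hw
  set wₜ : ℝ → (EuclideanSpace ℝ (Fin 3)) → ℝ := fun t x =>
    Real.exp (-2 * Λ t) * (-2 * lam t) * ‖om t x‖ ^ 2 +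
      Real.exp (-2 * Λ t) * (2 * ⟪om t x, omt t x⟫) -
      ε * (Real.exp (β * (t - t₀)) * β) * (1 + ‖x‖ ^ 2) with hwₜ
  set K : Set (EuclideanSpace ℝ (Fin 3)) := closedBall 0 R with hK
  set U : Set (EuclideanSpace ℝ (Fin 3)) := ball 0 R with hU
  have hKc : IsCompact K := isCompact_closedBall _ _
  have hUo : IsOpen U := isOpen_ball
  have hUK : U ⊆ K := ball_subset_closedBall
  -- regularity of the vorticity slices
  have homC : ∀ t ∈ Ico 0 T, ContDiff ℝ 2 (om t) := fun t ht =>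
    (homsm.contDiff_slice ht).of_le (by norm_cast)
  have homd : ∀ t ∈ Ico 0 T, ∀ x, DifferentiableAt ℝ (om t) x := fun t ht x =>
    ((homC t ht).of_le one_le_two).differentiable one_ne_zero x
  -- (a) joint continuity
  have hc : ContinuousOn (uncurry w) (Icc t₀ t₁ ×ˢ K) := by
    have homc : ContinuousOn (uncurry om) (Icc t₀ t₁ ×ˢ K) :=
      homsm.continuousOn.mono (prod_mono hsubI (subset_univ _))
    have hΛc' : ContinuousOn (fun q : ℝ × (EuclideanSpace ℝ (Fin 3)) => Λ q.1) (Icc t₀ t₁ ×ˢ K) :=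
      hΛc.comp continuous_fst.continuousOn fun q hq => hq.1
    have h1 : ContinuousOn (fun q : ℝ × (EuclideanSpace ℝ (Fin 3)) => Real.exp (-2 * Λ q.1) * ‖uncurry om q‖ ^ 2)
        (Icc t₀ t₁ ×ˢ K) :=
      ((continuousOn_const.mul hΛc').rexp).mul (homc.norm.pow 2)
    have h2 : Continuous fun q : ℝ × (EuclideanSpace ℝ (Fin 3)) =>
        M ^ 2 + ε * Real.exp (β * (q.1 - t₀)) * (1 + ‖q.2‖ ^ 2) := by
      fun_prop
    exact (h1.sub h2.continuousOn).congr fun q _ => by simp only [hw, uncurry, Pi.sub_apply]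
  -- (b) smooth slices
  have h2 : ∀ t ∈ Ioc t₀ t₁, ContDiff ℝ 2 (w t) := fun t ht =>
    (contDiff_const.mul ((homC t (hsubI ⟨ht.1.le, ht.2⟩)).norm_sq ℝ)).sub
      (contDiff_barrier (M ^ 2) (ε * Real.exp (β * (t - t₀))))
  -- (c) the left time derivative
  have ht : ∀ t ∈ Ioc t₀ t₁, ∀ x ∈ U, HasDerivWithinAt (fun s => w s x) (wₜ t x) (Icc t₀ t) t := by
    intro t ht x _
    have htS : t ∈ Ico 0 T := hsubI ⟨ht.1.le, ht.2⟩
    have homdt : HasDerivWithinAt (fun s => om s x) (omt t x) (Ico 0 T) t :=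
      homsm.hasDerivWithinAt_timeDerivWithin (uniqueDiffOn_Ico 0 T) htS x
    have hnsq : HasDerivWithinAt (fun s => ‖om s x‖ ^ 2) (2 * ⟪om t x, omt t x⟫) (Ico 0 T) t :=
      homdt.norm_sq
    have hexpΛ : HasDerivAt (fun s => Real.exp (-2 * Λ s)) (Real.exp (-2 * Λ t) * (-2 * lam t)) t :=
      ((hΛd t ht).const_mul (-2)).exp
    have hprod := hexpΛ.hasDerivWithinAt.mul hnsq
    have hbar : HasDerivWithinAt (fun s => M ^ 2 + ε * Real.exp (β * (s - t₀)) * (1 + ‖x‖ ^ 2))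
        (ε * (Real.exp (β * (t - t₀)) * β) * (1 + ‖x‖ ^ 2)) (Ico 0 T) t := by
      have h1 : HasDerivAt (fun s => Real.exp (β * (s - t₀))) (Real.exp (β * (t - t₀)) * β) t := by
        have := (((hasDerivAt_id t).sub_const t₀).const_mul β).exp
        simpa using this
      exact (((h1.const_mul ε).mul_const (1 + ‖x‖ ^ 2)).const_add (M ^ 2)).hasDerivWithinAt
    have h := (hprod.sub hbar).mono (show Icc t₀ t ⊆ Ico 0 T from
      fun s hs => ⟨ht₀.trans hs.1, (hs.2.trans ht.2).trans_lt ht₁⟩)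
    simp only [hw, hwₜ]
    exact h.congr_deriv (by ring)
  -- (d) the sub-solution implication, from the vorticity equation
  have hsub : ∀ t ∈ Ioc t₀ t₁, ∀ x ∈ U, fderiv ℝ (w t) x = 0 → (Δ (w t)) x ≤ 0 → wₜ t x ≤ 0 := by
    intro t ht x _ hgrad _
    have htI : t ∈ Icc t₀ t₁ := ⟨ht.1.le, ht.2⟩
    have htS : t ∈ Ico 0 T := hsubI htI
    set c : ℝ := ε * Real.exp (β * (t - t₀)) with hc
    have hc0 : 0 < c := by positivity
    set e : ℝ := Real.exp (-2 * Λ t) with he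
    have he0 : 0 < e := Real.exp_pos _
    -- the vorticity equation at `(t, x)`: `ωₜ + Dω(u) = Du(ω)`
    have hpde : omt t x = fderiv ℝ (u t) x (om t x) - fderiv ℝ (om t) x (u t x) := by
      have h := hvort.vorticity_eq t htS x
      rw [zero_smul, add_zero, convect_apply, convect_apply] at h
      simpa [homt, hom] using eq_sub_of_add_eq h
    -- the critical-point identity: `e · 2⟪ω, Dω a⟫ = c · 2⟪x, a⟫`
    have hB := hasFDerivAt_barrier (M ^ 2) c x
    have hN : HasFDerivAt (fun y => ‖om t y‖ ^ 2)
        ((2 : ℕ) • (innerSL ℝ (om t x)).comp (fderiv ℝ (om t) x)) x := by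
      have := (homd t htS x).hasFDerivAt.norm_sq
      simpa using this
    have hwderiv : HasFDerivAt (w t)
        (e • ((2 : ℕ) • (innerSL ℝ (om t x)).comp (fderiv ℝ (om t) x)) -
          c • ((2 : ℕ) • (innerSL ℝ x : (EuclideanSpace ℝ (Fin 3)) →L[ℝ] ℝ))) x := by
      have h := (hN.const_mul e).sub hB
      simp only [hw, hc, he]
      exact h
    have hDeq : e • ((2 : ℕ) • (innerSL ℝ (om t x)).comp (fderiv ℝ (om t) x)) =
        c • ((2 : ℕ) • (innerSL ℝ x : (EuclideanSpace ℝ (Fin 3)) →L[ℝ] ℝ)) := by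
      have := hwderiv.fderiv
      rw [hgrad] at this
      exact (sub_eq_zero.1 this.symm)
    have hDapply : ∀ a : (EuclideanSpace ℝ (Fin 3)), e * (2 * ⟪om t x, fderiv ℝ (om t) x a⟫) = c * (2 * ⟪x, a⟫) := fun a => by
      have := congrArg (fun L : (EuclideanSpace ℝ (Fin 3)) →L[ℝ] ℝ => L a) hDeq
      simpa [innerSL_apply_apply, nsmul_eq_mul] using this
    -- the transport term at the critical point
    have hconv : -(c * (2 * ⟪x, u t x⟫)) ≤ c * (2 * (‖x‖ * V)) := by
      have h1 : |⟪x, u t x⟫| ≤ ‖x‖ * ‖u t x‖ := abs_real_inner_le_norm _ _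
      have h2 : ‖x‖ * ‖u t x‖ ≤ ‖x‖ * V := mul_le_mul_of_nonneg_left (hV t htI x) (norm_nonneg _)
      have h3 := (abs_le.1 (h1.trans h2)).1
      nlinarith
    -- the stretching term: `⟪ω, Du ω⟫ ≤ λ |ω|²`
    have hstretch : ⟪om t x, fderiv ℝ (u t) x (om t x)⟫ ≤ lam t * ‖om t x‖ ^ 2 := by
      calc ⟪om t x, fderiv ℝ (u t) x (om t x)⟫ ≤ ‖om t x‖ * ‖fderiv ℝ (u t) x (om t x)‖ :=
            real_inner_le_norm _ _
        _ ≤ ‖om t x‖ * (‖fderiv ℝ (u t) x‖ * ‖om t x‖) :=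
            mul_le_mul_of_nonneg_left (ContinuousLinearMap.le_opNorm _ _) (norm_nonneg _)
        _ ≤ ‖om t x‖ * (lam t * ‖om t x‖) := by
            gcongr
            exact hD t ht x
        _ = lam t * ‖om t x‖ ^ 2 := by ring
    -- `e · 2⟪ω, ωₜ⟫ = e · 2⟪ω, Du ω⟫ − c · 2⟪x, u⟫`
    have hkey : e * (2 * ⟪om t x, omt t x⟫) =
        e * (2 * ⟪om t x, fderiv ℝ (u t) x (om t x)⟫) - c * (2 * ⟪x, u t x⟫) := by
      rw [hpde, inner_sub_right, ← hDapply (u t x)]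
      ring
    -- assemble
    set A : ℝ := c * (1 + ‖x‖ ^ 2) with hA
    have hA0 : 0 ≤ A := by positivity
    have hx2 : 2 * (‖x‖ * V) ≤ V * (1 + ‖x‖ ^ 2) := by
      nlinarith [sq_nonneg (‖x‖ - 1), norm_nonneg x]
    have hx2' : c * (2 * (‖x‖ * V)) ≤ V * A := by
      calc c * (2 * (‖x‖ * V)) ≤ c * (V * (1 + ‖x‖ ^ 2)) := mul_le_mul_of_nonneg_left hx2 hc0.le
        _ = V * A := by rw [hA]; ring
    have e3 : wₜ t x = e * (-2 * lam t) * ‖om t x‖ ^ 2 + e * (2 * ⟪om t x, omt t x⟫) - β * A := by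
      simp only [hwₜ, hA, hc, he]; ring
    have hst' : e * (2 * ⟪om t x, fderiv ℝ (u t) x (om t x)⟫) ≤ e * (2 * (lam t * ‖om t x‖ ^ 2)) := by
      gcongr
    have e2 : β * A = V * A + A := by rw [hβ]; ring
    rw [e3, hkey]
    nlinarith
  -- (e) the parabolic boundary: `t = t₀`
  have hbot : ∀ x ∈ K, w t₀ x ≤ 0 := by
    intro x _
    have hwt : w t₀ x = Real.exp (-2 * Λ t₀) * ‖om t₀ x‖ ^ 2 -
        (M ^ 2 + ε * Real.exp (β * (t₀ - t₀)) * (1 + ‖x‖ ^ 2)) := rfl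
    rw [hwt, hΛ0, sub_self, mul_zero, mul_zero, Real.exp_zero, one_mul, mul_one]
    have h1 : ‖om t₀ x‖ ^ 2 ≤ M ^ 2 := by
      rw [hom_app]
      exact pow_le_pow_left₀ (norm_nonneg _) (hM x) 2
    have h3 : 0 ≤ ε * (1 + ‖x‖ ^ 2) := by positivity
    linarith
  -- (f) the parabolic boundary: the sphere `|x| = R`
  have hlat : ∀ t ∈ Icc t₀ t₁, ∀ x ∈ K \ U, w t x ≤ 0 := by
    intro t ht x hx
    have hexp1 : 1 ≤ Real.exp (β * (t - t₀)) := Real.one_le_exp (mul_nonneg hβ0 (by linarith [ht.1]))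
    have hH : ε * (1 + ‖x‖ ^ 2) ≤ ε * Real.exp (β * (t - t₀)) * (1 + ‖x‖ ^ 2) := by
      have : ε * (1 + ‖x‖ ^ 2) * 1 ≤ ε * (1 + ‖x‖ ^ 2) * Real.exp (β * (t - t₀)) :=
        mul_le_mul_of_nonneg_left hexp1 (by positivity)
      linarith
    have hxK : ‖x‖ ≤ R := mem_closedBall_zero_iff.1 hx.1
    have hxR : ‖x‖ = R := by
      have hnot : x ∉ ball (0 : (EuclideanSpace ℝ (Fin 3))) R := hx.2
      have : R ≤ ‖x‖ := by simpa using hnot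
      exact le_antisymm hxK this
    -- `e^{-2Λ} |ω|² ≤ W²`
    have homW : Real.exp (-2 * Λ t) * ‖om t x‖ ^ 2 ≤ W ^ 2 := by
      have h1 : ‖om t x‖ ^ 2 ≤ W ^ 2 := by
        rw [hom_app]
        exact pow_le_pow_left₀ (norm_nonneg _) (hW t ht x) 2
      have h2 : Real.exp (-2 * Λ t) ≤ 1 := by
        rw [Real.exp_le_one_iff]
        have := hΛnn t ht
        linarith
      calc Real.exp (-2 * Λ t) * ‖om t x‖ ^ 2 ≤ 1 * ‖om t x‖ ^ 2 :=
            mul_le_mul_of_nonneg_right h2 (by positivity)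
        _ ≤ W ^ 2 := by rw [one_mul]; exact h1
    -- `W² ≤ ε R ≤ ε (1 + R²)`
    have hWR : W ^ 2 ≤ ε * (1 + ‖x‖ ^ 2) := by
      rw [hxR]
      have h1 : W ^ 2 ≤ ε * R := by rwa [div_le_iff₀' hε] at hR
      have h2 : R ≤ 1 + R ^ 2 := by nlinarith [sq_nonneg (R - 1)]
      nlinarith
    have hwt : w t x = Real.exp (-2 * Λ t) * ‖om t x‖ ^ 2 -
        (M ^ 2 + ε * Real.exp (β * (t - t₀)) * (1 + ‖x‖ ^ 2)) := rfl
    rw [hwt]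
    have hM2 : 0 ≤ M ^ 2 := sq_nonneg M
    linarith
  exact weak_max_principle hKc hUo hUK hc h2 ht hsub hbot hlat

/-! ### Step 2: the rate `‖ω(t)‖_∞ ≤ ‖ω(t₀)‖_∞ ((T − t₀)/(T − t))^{M₀}` -/

/-- **Chae 2010, proof of Theorem 1.1, the rate** ("`‖ω(t)‖_∞ ≤ ‖ω(t₀)‖_∞ exp[M₀ ∫_{t₀}^t
(T−τ)⁻¹ dτ] = ‖ω(t₀)‖_∞ ((T−t₀)/(T−t))^{M₀}`", arXiv:0711.1113 p. 3). Let `(u, p)` be a classical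
Euler solution on `ℝ³ × [0, T)` of the Beale–Kato–Majda class (all Sobolev norms bounded on every
`[0, T'']`, `T'' < T`), let `t₀ ∈ [0, T)`, `0 ≤ M₀`, and assume the Type-I gradient bound
`(T − t) ‖D(u t)(x)‖ ≤ M₀` for all `t ∈ [t₀, T)` and all `x`. If `‖ω(t₀, x)‖ ≤ M` for all `x`, then
`‖ω(t, x)‖ ≤ M ((T − t₀)/(T − t))^{M₀}` for all `t ∈ [t₀, T)`, `x ∈ ℝ³` — step 1 with the weight
`Λ(s) = M₀ (log(T − t₀) − log(T − s))`, `Λ′(s) = M₀/(T − s)`; the velocity and vorticity sup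
bounds on `[t₀, t]` come from the class (`exists_forall_norm_iteratedFDeriv_le_bkmClass`,
`exists_enorm_curl_le_of_hasBoundedSobolevNormsOn`).
[cite: Chae2010, Thm 1.1 (proof, arXiv:0711.1113 p. 3)] -/
theorem norm_curl_le_mul_rpow_of_typeI_gradient
    {T t₀ M₀ M : ℝ} {u : ℝ → (EuclideanSpace ℝ (Fin 3)) → (EuclideanSpace ℝ (Fin 3))} {p : ℝ → (EuclideanSpace ℝ (Fin 3)) → ℝ}
    (hcl : IsClassicalNSSolutionOn (Ico 0 T) 0 0 u p)
    (hreg : ∀ T'' < T, HasBoundedSobolevNormsOn (Icc 0 T'') u)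
    (ht₀ : t₀ ∈ Ico 0 T) (hM₀ : 0 ≤ M₀)
    (hbd : ∀ t ∈ Ico t₀ T, ∀ x, (T - t) * ‖fderiv ℝ (u t) x‖ ≤ M₀)
    (hM : ∀ x, ‖curl (u t₀) x‖ ≤ M) :
    ∀ t ∈ Ico t₀ T, ∀ x, ‖curl (u t) x‖ ≤ M * ((T - t₀) / (T - t)) ^ M₀ := by
  intro t ht x
  have hTt : 0 < T - t := sub_pos.2 ht.2
  have hTt₀ : 0 < T - t₀ := sub_pos.2 ht₀.2
  -- velocity and vorticity bounds on the slab `[t₀, t] × ℝ³` from the class on `[0, t]`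
  have hB := hreg t ht.2
  have hsmooth : ∀ s ∈ Icc 0 t, ContDiff ℝ ∞ (u s) := fun s hs =>
    hcl.contDiff_velocity ⟨hs.1, hs.2.trans_lt ht.2⟩
  obtain ⟨V, -, hV⟩ := exists_forall_norm_iteratedFDeriv_le_bkmClass hsmooth hB 0
  obtain ⟨R, hRtop, hR⟩ := exists_enorm_curl_le_of_hasBoundedSobolevNormsOn hsmooth hB
  have hV' : ∀ s ∈ Icc t₀ t, ∀ y, ‖u s y‖ ≤ V := fun s hs y => by
    have := hV s ⟨ht₀.1.trans hs.1, hs.2⟩ y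
    rwa [norm_iteratedFDeriv_zero] at this
  have hW' : ∀ s ∈ Icc t₀ t, ∀ y, ‖curl (u s) y‖ ≤ R.toReal := fun s hs y =>
    calc ‖curl (u s) y‖ = (‖curl (u s) y‖ₑ).toReal := (toReal_enorm _).symm
      _ ≤ R.toReal := ENNReal.toReal_mono hRtop.ne (hR s ⟨ht₀.1.trans hs.1, hs.2⟩ y)
  -- the weight `Λ(s) = M₀ (log (T − t₀) − log (T − s))`, `Λ′(s) = M₀/(T − s)`
  set Λ : ℝ → ℝ := fun s => M₀ * (Real.log (T - t₀) - Real.log (T - s)) with hΛ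
  set lam : ℝ → ℝ := fun s => M₀ / (T - s) with hlam
  have hΛc : ContinuousOn Λ (Icc t₀ t) := by
    have h1 : ContinuousOn (fun s : ℝ => Real.log (T - s)) (Icc t₀ t) :=
      (continuousOn_const.sub continuousOn_id).log fun s hs =>
        (sub_pos.2 (lt_of_le_of_lt hs.2 ht.2)).ne'
    exact continuousOn_const.mul (continuousOn_const.sub h1)
  have hΛ0 : Λ t₀ = 0 := by simp [hΛ]
  have hΛnn : ∀ s ∈ Icc t₀ t, 0 ≤ Λ s := fun s hs => by
    have hTs : 0 < T - s := sub_pos.2 (lt_of_le_of_lt hs.2 ht.2)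
    have h1 := Real.log_le_log hTs (by linarith [hs.1] : T - s ≤ T - t₀)
    exact mul_nonneg hM₀ (by linarith)
  have hΛd : ∀ s ∈ Ioc t₀ t, HasDerivAt Λ (lam s) s := fun s hs => by
    have hTs : 0 < T - s := sub_pos.2 (lt_of_le_of_lt hs.2 ht.2)
    have h1 : HasDerivAt (fun r : ℝ => T - r) (-1) s := by
      simpa using (hasDerivAt_id s).const_sub T
    have h3 := ((h1.log hTs.ne').const_sub (Real.log (T - t₀))).const_mul M₀
    refine h3.congr_deriv ?_
    rw [hlam]
    field_simp
  have hD : ∀ s ∈ Ioc t₀ t, ∀ y, ‖fderiv ℝ (u s) y‖ ≤ lam s := fun s hs y => by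
    have hTs : 0 < T - s := sub_pos.2 (lt_of_le_of_lt hs.2 ht.2)
    have h1 := hbd s ⟨hs.1.le, lt_of_le_of_lt hs.2 ht.2⟩ y
    show ‖fderiv ℝ (u s) y‖ ≤ M₀ / (T - s)
    rw [le_div_iff₀ hTs, mul_comm]
    exact h1
  have key := exp_neg_mul_norm_curl_le_of_classicalEuler hcl ht₀.1 ht.1 ht.2 hV' hW' hM hΛc hΛ0
    hΛnn hΛd hD t ⟨ht.1, le_rfl⟩ x
  -- `e^{−Λ(t)} = ((T − t)/(T − t₀))^{M₀}`
  have hexp : Real.exp (-Λ t) = ((T - t) / (T - t₀)) ^ M₀ := by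
    rw [Real.rpow_def_of_pos (div_pos hTt hTt₀), Real.log_div hTt.ne' hTt₀.ne']
    congr 1
    simp only [hΛ]
    ring
  rw [hexp] at key
  have hq : 0 < ((T - t) / (T - t₀)) ^ M₀ := Real.rpow_pos_of_pos (div_pos hTt hTt₀) _
  have hinv : ((T - t₀) / (T - t)) ^ M₀ = (((T - t) / (T - t₀)) ^ M₀)⁻¹ := by
    rw [← Real.inv_rpow (div_pos hTt hTt₀).le, inv_div]
  rw [hinv, ← div_eq_mul_inv, le_div_iff₀ hq, mul_comm]
  exact key

/-! ### Step 3: the discharge of Theorem 1.1 -/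

/-- **Chae 2010, Theorem 1.1, discharged**: `theorem chae2010_euler_typeI_threshold_holds :
chae2010_euler_typeI_threshold` (J. Funct. Anal. 258 (2010), Thm 1.1 = arXiv:0711.1113, Thm 1.1, in
the rendering of `ChaeGeneralizedSelfSimilar.lean`: a classical unforced Euler solution on
`ℝ³ × [0, T)` of the Beale–Kato–Majda class with `(T − t)‖D(u(t))(x)‖ ≤ M₀ < 1` on `[t₀, T) × ℝ³`
continues in the class past `T`). Proof as printed (module docstring): the vorticity is bounded on
`[0, t₀]` in the class and obeys `‖ω(t, x)‖ ≤ ‖ω(t₀)‖_∞((T − t₀)/(T − t))^{M₀}` on `[t₀, T)`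
(`norm_curl_le_mul_rpow_of_typeI_gradient`); since `M₀ < 1`, `t ↦ (T − t)^{−M₀}` is integrable on
`(0, T)`, so `∫₀ᵀ ‖ω(t)‖_∞ dt < ∞`, and the Beale–Kato–Majda criterion (`beale_kato_majda_holds`,
`ν = 0`) gives `HasSobolevExtensionPast 0 u T`.
[cite: Chae2010, Thm 1.1 (= arXiv:0711.1113 Thm 1.1, proof p. 3–4); BealeKatoMajda1984, Thm 1] -/
theorem chae2010_euler_typeI_threshold_holds : chae2010_euler_typeI_threshold := by
  intro T hT u p hsol hreg hM
  obtain ⟨M₀, hM₀1, t₀, ht₀, hbd⟩ := hM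
  have hM₀0 : 0 ≤ M₀ :=
    le_trans (mul_nonneg (sub_nonneg.2 ht₀.2.le) (norm_nonneg _)) (hbd t₀ ⟨le_rfl, ht₀.2⟩ 0)
  -- the vorticity is bounded on `[0, t₀]` in the class
  have hsm0 : ∀ s ∈ Icc 0 t₀, ContDiff ℝ ∞ (u s) := fun s hs =>
    hsol.contDiff_velocity ⟨hs.1, hs.2.trans_lt ht₀.2⟩
  obtain ⟨R₀, hR₀top, hR₀⟩ :=
    exists_enorm_curl_le_of_hasBoundedSobolevNormsOn hsm0 (hreg t₀ ht₀.2)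
  set M : ℝ := R₀.toReal with hMdef
  have hMt₀ : ∀ x, ‖curl (u t₀) x‖ ≤ M := fun x =>
    calc ‖curl (u t₀) x‖ = (‖curl (u t₀) x‖ₑ).toReal := (toReal_enorm _).symm
      _ ≤ M := ENNReal.toReal_mono hR₀top.ne (hR₀ t₀ ⟨ht₀.1, le_rfl⟩ x)
  -- the growth bound on `[t₀, T)`
  have hgrowth := norm_curl_le_mul_rpow_of_typeI_gradient hsol hreg ht₀ hM₀0 hbd hMt₀
  -- a majorant of `t ↦ ‖ω(t)‖_∞` on `(0, T)`
  set C : ℝ := M * (T - t₀) ^ M₀ with hC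
  have hmaj : ∀ t ∈ Ioo 0 T,
      (⨆ x, ‖curl (u t) x‖ₑ) ≤ R₀ + ENNReal.ofReal (C * (T - t) ^ (-M₀)) := by
    intro t ht
    refine iSup_le fun x => ?_
    rcases le_or_gt t t₀ with hle | hlt
    · exact (hR₀ t ⟨ht.1.le, hle⟩ x).trans le_self_add
    · have h1 := hgrowth t ⟨hlt.le, ht.2⟩ x
      have h2 : M * ((T - t₀) / (T - t)) ^ M₀ = C * (T - t) ^ (-M₀) := by
        rw [hC, Real.div_rpow (sub_pos.2 ht₀.2).le (sub_pos.2 ht.2).le,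
          Real.rpow_neg (sub_pos.2 ht.2).le]
        ring
      calc ‖curl (u t) x‖ₑ = ENNReal.ofReal ‖curl (u t) x‖ := (ofReal_norm _).symm
        _ ≤ ENNReal.ofReal (C * (T - t) ^ (-M₀)) := ENNReal.ofReal_le_ofReal (h1.trans_eq h2)
        _ ≤ R₀ + ENNReal.ofReal (C * (T - t) ^ (-M₀)) := le_add_self
  -- `t ↦ (T − t)^{−M₀}` is integrable on `(0, T)` since `M₀ < 1`
  have hint : IntegrableOn (fun t : ℝ => C * (T - t) ^ (-M₀)) (Ioo 0 T) volume := by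
    have h1 : IntervalIntegrable (fun x : ℝ => x ^ (-M₀)) volume T 0 :=
      intervalIntegral.intervalIntegrable_rpow' (by linarith)
    have h2 := h1.comp_sub_left T
    rw [sub_self, sub_zero] at h2
    exact ((intervalIntegrable_iff_integrableOn_Ioo_of_le hT.le).1 h2).const_mul C
  -- `∫₀ᵀ ‖ω(t)‖_∞ dt < ∞`
  have hfin : (∫⁻ t in Ioo 0 T, ⨆ x, ‖curl (u t) x‖ₑ) < ⊤ := by
    calc (∫⁻ t in Ioo 0 T, ⨆ x, ‖curl (u t) x‖ₑ)
        ≤ ∫⁻ t in Ioo 0 T, (R₀ + ENNReal.ofReal (C * (T - t) ^ (-M₀))) :=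
          setLIntegral_mono' measurableSet_Ioo hmaj
      _ = (∫⁻ _ in Ioo 0 T, R₀) + ∫⁻ t in Ioo 0 T, ENNReal.ofReal (C * (T - t) ^ (-M₀)) :=
          lintegral_add_left measurable_const _
      _ < ⊤ := by
          refine ENNReal.add_lt_top.2 ⟨?_, ?_⟩
          · rw [setLIntegral_const, Real.volume_Ioo]
            exact ENNReal.mul_lt_top hR₀top ENNReal.ofReal_lt_top
          · exact lt_of_le_of_lt (lintegral_mono fun t => Real.ofReal_le_enorm _) hint.2
  -- Beale–Kato–Majda (`ν = 0`)
  exact (beale_kato_majda_holds le_rfl hT hsol hreg).2 hfin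

/-! ### Corollary 1.1, now unconditional -/

/-- **Chae 2010, Corollary 1.1, unconditional** ("There exists no self-similar blow-up for the
solution of the 3D Euler equations with the blow-up profile `V̄` satisfying `‖∇V̄‖_{L^∞} < 1`"):
if a classical unforced Euler solution `(u, p)` on `ℝ³ × [0, T)` of the Beale–Kato–Majda class
coincides on `[t₀, T)`, `t₀ ∈ [0, T)`, with the exact power-law ansatz `selfSimilarCollapse γ T U`
(`u(t, x) = (T−t)^{γ−1} U(x/(T−t)^γ)`, any exponent `γ`) whose profile has `‖DU(y)‖ ≤ M₀ < 1` for
all `y`, then `u` continues in the class past `T`. The tree's conditional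
`chae2010_euler_typeI_threshold.selfSimilarCollapse_continues` fed with
`chae2010_euler_typeI_threshold_holds`. [cite: Chae2010, Cor 1.1 (JFA §1)] -/
theorem selfSimilarEulerCollapse_continues_of_norm_fderiv_lt_one {T : ℝ} (hT : 0 < T)
    {u : ℝ → (EuclideanSpace ℝ (Fin 3)) → (EuclideanSpace ℝ (Fin 3))} {p : ℝ → (EuclideanSpace ℝ (Fin 3)) → ℝ} (hsol : IsClassicalEulerSolutionOn (Ico 0 T) 0 u p)
    (hreg : ∀ T'' < T, HasBoundedSobolevNormsOn (Icc 0 T'') u)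
    {γ : ℝ} {U : (EuclideanSpace ℝ (Fin 3)) → (EuclideanSpace ℝ (Fin 3))} {t₀ : ℝ} (ht₀ : t₀ ∈ Ico 0 T)
    (hrepr : ∀ t ∈ Ico t₀ T, u t = selfSimilarCollapse γ T U t)
    {M₀ : ℝ} (hM₀ : M₀ < 1) (hDU : ∀ y : (EuclideanSpace ℝ (Fin 3)), ‖fderiv ℝ U y‖ ≤ M₀) :
    HasSobolevExtensionPast 0 u T :=
  chae2010_euler_typeI_threshold_holds.selfSimilarCollapse_continues hT hsol hreg ht₀ hrepr hM₀ hDU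

/-- **Chae 2010, Corollary 1.1 in blow-up form, unconditional**: if `T` IS a blow-up time of the
Beale–Kato–Majda class for a classical unforced Euler solution on `ℝ³ × [0, T)` (no continuation in
the class past `T`) and the solution is the exact power-law ansatz `selfSimilarCollapse γ T U` on
`[t₀, T)`, then `sup_y ‖DU(y)‖ ≥ 1`: for every `M₀ < 1` some `y` has `‖DU(y)‖ > M₀` — a
scale-invariant floor on every exact self-similar Euler blow-up profile of the class, whatever its
collapse exponent `γ` (Chae's `α = 1/γ − 1`). The tree's conditional
`chae2010_euler_typeI_threshold.exists_norm_fderiv_gt_of_blowup` fed with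
`chae2010_euler_typeI_threshold_holds`. [cite: Chae2010, Cor 1.1 (JFA §1)] -/
theorem exists_norm_fderiv_gt_of_selfSimilarEulerBlowup {T : ℝ} (hT : 0 < T)
    {u : ℝ → (EuclideanSpace ℝ (Fin 3)) → (EuclideanSpace ℝ (Fin 3))} {p : ℝ → (EuclideanSpace ℝ (Fin 3)) → ℝ} (hsol : IsClassicalEulerSolutionOn (Ico 0 T) 0 u p)
    (hreg : ∀ T'' < T, HasBoundedSobolevNormsOn (Icc 0 T'') u)
    (hblowup : ¬ HasSobolevExtensionPast 0 u T)
    {γ : ℝ} {U : (EuclideanSpace ℝ (Fin 3)) → (EuclideanSpace ℝ (Fin 3))} {t₀ : ℝ} (ht₀ : t₀ ∈ Ico 0 T)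
    (hrepr : ∀ t ∈ Ico t₀ T, u t = selfSimilarCollapse γ T U t)
    {M₀ : ℝ} (hM₀ : M₀ < 1) : ∃ y : (EuclideanSpace ℝ (Fin 3)), M₀ < ‖fderiv ℝ U y‖ :=
  chae2010_euler_typeI_threshold_holds.exists_norm_fderiv_gt_of_blowup hT hsol hreg hblowup ht₀
    hrepr hM₀

end Literature.Analysis.FluidPDE

end
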